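import Literature.MathematicalPhysics.QuantumLattice.TIGroundEnergyDensityResponse
import Literature.MathematicalPhysics.QuantumLattice.InfVolFermionStateBounds
import HarnessLib

/-!
# Weak-⋆ limits of infinite-volume fermion states: sequential compactness of the state space, and
# translation-invariant ground states (mean-energy minimisers) EXIST for every finite-range interaction

Topic `Literature/MathematicalPhysics/QuantumLattice`; namespace
`Literature.MathematicalPhysics.QuantumLattice` (the file path). Companion of
`InfVolFermionStateCompactness.lean` (weak-⋆ compactness for translation-AVERAGED TORUS vectors) and of
`TIGroundEnergyDensityResponse.lean` (the variational ground-state energy density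
`e₀(Ψ) = tiGroundEnergyDensity Ψ R = inf {e_Ψ(ω) : ω translation invariant}` and its minimisers
`IsMeanEnergyMinimiser`). Written for the Hubbard cuprate cell (`hubbard-cq`, row p5: the infinite-volume
reading of the pinning-field dictionary — limits `h → 0⁺` of SOURCED translation-invariant ground states).
Everything is PROVED; no definition, no named fact.

## Results

* `InfVolFermionState.expect_eq_sum_single`: `ω_Λ(A) = Σ_{s,t} A_{st} ω_Λ(|s⟩⟨t|)` (coordinates).
* `InfVolFermionState.exists_tendsto_expect_subseq` — **SEQUENTIAL BANACH–ALAOGLU for the CAR algebra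
  over `ℤ^d`**: every sequence `ω_j` of infinite-volume states has a subsequence `ω_{φ j}` and a state
  `ωl` with `ω_{φ j, Λ}(A) → ωl_Λ(A)` for EVERY finite region `Λ` and every `A ∈ 𝔄_Λ` (weak-⋆ convergence
  on the dense local algebra). Proof: Tychonoff on the countably many matrix-unit coordinates, each in the
  closed disc of radius `‖|s⟩⟨t|‖` (`norm_expect_le`); linearity, normalisation, positivity and
  compatibility are closed conditions (Bratteli–Robinson I, Thm. 2.3.15).
* Closed properties under such pointwise limits: translation invariance
  (`isTranslationInvariant_of_tendsto_expect`), evenness (`isEven_of_tendsto_expect`), the mean energy is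
  continuous (`tendsto_meanEnergy_of_tendsto_expect`), minimisation of the mean energy at a FIXED
  interaction (`isMeanEnergyMinimiser_of_tendsto_expect`) and ALONG A PENCIL `Ψ₀ + s_j Ψ₁` with
  `s_j → sl` (`isMeanEnergyMinimiser_pencil_of_tendsto_expect` — limits of ground states at couplings
  `s_j` are ground states at the limit coupling; this is how Koma–Tasaki's `h → 0⁺` limit of sourced
  ground states produces a source-free ground state).
* `FermionInteraction.exists_isMeanEnergyMinimiser` — **translation-invariant ground states exist**: for
  every interaction `Ψ` and range parameter `R` there is a translation-invariant state `ω` with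
  `e_Ψ(ω) = e₀(Ψ)` (a minimising sequence has a convergent subsequence; Bratteli–Kishimoto–Robinson 1978,
  Thm. 2 / Bratteli–Robinson II, Prop. 6.2.15 ff.: the set of translation-invariant ground states is a
  non-empty face).

## References
* O. Bratteli, D. W. Robinson, *Operator Algebras and Quantum Statistical Mechanics 1*, 2nd ed.,
  Thm. 2.3.15 (the state space is weak-⋆ compact), §4.3.1. [cite: BratteliRobinsonI1987, Thm. 2.3.15]
* O. Bratteli, A. Kishimoto, D. W. Robinson, CMP 64 (1978) 41, Thm. 2 (translation-invariant ground
  states = mean-energy minimisers). [cite: BratteliKishimotoRobinson1978, Thm. 2]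
* T. Koma, H. Tasaki, J. Stat. Phys. 76 (1994) 745, §1 (volume limit first, then `h → 0`).
  [cite: KomaTasaki1994, §1]

## What is NOT here
No uniqueness of limits, no metrisability statement for the weak-⋆ topology (only sequences are
treated), nothing model-specific (the Hubbard reading is `DWaveOrderParameterInfiniteVolume.lean`).
-/

noncomputable section

namespace Literature.MathematicalPhysics.QuantumLattice

open Matrix Finset HubbardWave0 _root_.Filter Literature.Probability.LatticeModels
open scoped _root_.Topology ComplexOrder

variable {d : ℕ}

namespace InfVolFermionState

/-! ### Coordinates: expansion in matrix units -/

/-- **Expansion in matrix units**: `ω_Λ(A) = Σ_{s,t} A_{st} · ω_Λ(|s⟩⟨t|)` — a state is determined, on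
each local algebra, by its countably many matrix-unit coordinates (the density-matrix description
`ω_Λ(A) = Tr(ρ_Λ A)`, Bratteli–Robinson I §2.6). [cite: BratteliRobinsonI1987, §2.6, display after Def. 2.6.6 (PDF p. 129)] -/
theorem expect_eq_sum_single (ω : InfVolFermionState d) (Λ : Finset (Site d)) (A : FermionOp Λ) :
    ω.expect Λ A = ∑ s, ∑ t, A s t * ω.expect Λ (Matrix.single s t (1 : ℂ)) := by
  conv_lhs => rw [Matrix.matrix_eq_sum_single A, map_sum]
  simp only [map_sum]
  refine Finset.sum_congr rfl fun s _ => Finset.sum_congr rfl fun t _ => ?_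
  rw [← smul_eq_mul, ← map_smul, Matrix.smul_single, smul_eq_mul, mul_one]

/-! ### Sequential weak-⋆ compactness of the state space -/

open scoped Matrix.Norms.L2Operator in
/-- **Sequential Banach–Alaoglu for the lattice fermions.** Every sequence `ω_j` of infinite-volume
states of the CAR algebra over `ℤ^d × {↑,↓}` has a subsequence `ω_{φ j}` (`φ` strictly increasing) and
an infinite-volume state `ωl` such that `ω_{φ j, Λ}(A) → ωl_Λ(A)` for every finite region `Λ` and every
local observable `A ∈ 𝔄_Λ` (weak-⋆ convergence on the local algebras). Cantor–Tychonoff diagonal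
argument on the matrix-unit coordinates `ω_{j,Λ}(|s⟩⟨t|)`, each bounded by `‖|s⟩⟨t|‖`
(`norm_expect_le`); the limit functional is linear, normalised, positive and compatible with isotony
because these are closed conditions holding at every `j`.
[cite: BratteliRobinsonI1987, Thm. 2.3.15 (weak-⋆ compactness of the state space)] -/
theorem exists_tendsto_expect_subseq (ω : ℕ → InfVolFermionState d) :
    ∃ φ : ℕ → ℕ, StrictMono φ ∧ ∃ ωl : InfVolFermionState d,
      ∀ (Λ : Finset (Site d)) (A : FermionOp Λ),
        Tendsto (fun j => (ω (φ j)).expect Λ A) atTop (𝓝 (ωl.expect Λ A)) := by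
  classical
  -- coordinates: the values on the matrix units `|s⟩⟨t|` of all local algebras
  let c : ℕ → (Σ Λ : Finset (Site d), Finset (Orb (PolySite Λ)) × Finset (Orb (PolySite Λ))) → ℂ :=
    fun j i => (ω j).expect i.1 (Matrix.single i.2.1 i.2.2 (1 : ℂ))
  let r : (Σ Λ : Finset (Site d), Finset (Orb (PolySite Λ)) × Finset (Orb (PolySite Λ))) → ℝ :=
    fun i => ‖(Matrix.single i.2.1 i.2.2 (1 : ℂ) : FermionOp i.1)‖
  have hK : IsCompact (Set.pi Set.univ fun i :
      (Σ Λ : Finset (Site d), Finset (Orb (PolySite Λ)) × Finset (Orb (PolySite Λ))) =>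
        Metric.closedBall (0 : ℂ) (r i)) :=
    isCompact_univ_pi fun i => isCompact_closedBall (0 : ℂ) (r i)
  have hc : ∀ j, c j ∈ Set.pi Set.univ fun i :
      (Σ Λ : Finset (Site d), Finset (Orb (PolySite Λ)) × Finset (Orb (PolySite Λ))) =>
        Metric.closedBall (0 : ℂ) (r i) := fun j i _ => by
    rw [Metric.mem_closedBall, dist_zero_right]
    exact (ω j).norm_expect_le _ _
  obtain ⟨g, -, φ, hφ, hg⟩ := hK.tendsto_subseq hc
  have hcoord : ∀ i : (Σ Λ : Finset (Site d), Finset (Orb (PolySite Λ)) × Finset (Orb (PolySite Λ))),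
      Tendsto (fun j => c (φ j) i) atTop (𝓝 (g i)) := fun i => tendsto_pi_nhds.1 hg i
  -- the limit functional and the convergence of all local expectations along the subsequence
  let lim : ∀ Λ : Finset (Site d), FermionOp Λ → ℂ := fun Λ A => ∑ s, ∑ t, A s t * g ⟨Λ, (s, t)⟩
  have hlim : ∀ (Λ : Finset (Site d)) (A : FermionOp Λ),
      Tendsto (fun j => (ω (φ j)).expect Λ A) atTop (𝓝 (lim Λ A)) := by
    intro Λ A
    have hrw : (fun j => (ω (φ j)).expect Λ A) =
        fun j => ∑ s, ∑ t, A s t * (ω (φ j)).expect Λ (Matrix.single s t (1 : ℂ)) :=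
      funext fun j => expect_eq_sum_single _ Λ A
    rw [hrw]
    refine tendsto_finsetSum _ fun s _ => tendsto_finsetSum _ fun t _ => ?_
    exact (hcoord ⟨Λ, (s, t)⟩).const_mul _
  -- the limit functional is linear
  let E : ∀ Λ : Finset (Site d), FermionOp Λ →ₗ[ℂ] ℂ := fun Λ =>
    { toFun := lim Λ
      map_add' := fun A B => by
        simp only [lim, Matrix.add_apply, add_mul, Finset.sum_add_distrib]
      map_smul' := fun a A => by
        simp only [lim, Matrix.smul_apply, smul_eq_mul, mul_assoc, Finset.mul_sum, RingHom.id_apply] }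
  -- normalisation
  have h_one : ∀ Λ : Finset (Site d), E Λ 1 = 1 := by
    intro Λ
    refine tendsto_nhds_unique (hlim Λ 1) ?_
    have hrw : (fun j => (ω (φ j)).expect Λ 1) = fun _ => (1 : ℂ) := funext fun j => (ω (φ j)).expect_one Λ
    rw [hrw]
    exact tendsto_const_nhds
  -- positivity
  have h_nonneg : ∀ (Λ : Finset (Site d)) (A : FermionOp Λ), 0 ≤ E Λ (Aᴴ * A) := fun Λ A =>
    ge_of_tendsto' (hlim Λ (Aᴴ * A)) fun j => (ω (φ j)).expect_nonneg Λ A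
  -- compatibility
  have h_comp : ∀ ⦃Λ Λ' : Finset (Site d)⦄ (h : Λ ⊆ Λ') (A : FermionOp Λ),
      E Λ' (fermionEmbed (PolySite.incl h) A) = E Λ A := by
    intro Λ Λ' h A
    refine tendsto_nhds_unique (hlim Λ' (fermionEmbed (PolySite.incl h) A)) ?_
    have hrw : (fun j => (ω (φ j)).expect Λ' (fermionEmbed (PolySite.incl h) A)) =
        fun j => (ω (φ j)).expect Λ A := funext fun j => (ω (φ j)).compatible h A
    rw [hrw]
    exact hlim Λ A
  exact ⟨φ, hφ, ⟨E, h_one, h_nonneg, h_comp⟩, fun Λ A => hlim Λ A⟩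

/-! ### Closed properties under pointwise (weak-⋆) limits -/

section Closed

variable {ω : ℕ → InfVolFermionState d} {ωl : InfVolFermionState d}

/-- **Translation invariance passes to weak-⋆ limits**: if every `ω_j` is translation invariant and
`ω_{j,Λ}(A) → ωl_Λ(A)` for all `Λ, A`, then `ωl` is translation invariant (the sequences defining
`(ωl ∘ τ_v)_Λ(A)` and `ωl_Λ(A)` coincide term by term). [cite: BratteliRobinsonI1987, §4.3.1] -/
theorem isTranslationInvariant_of_tendsto_expect
    (hlim : ∀ (Λ : Finset (Site d)) (A : FermionOp Λ),
      Tendsto (fun j => (ω j).expect Λ A) atTop (𝓝 (ωl.expect Λ A)))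
    (hTI : ∀ j, (ω j).IsTranslationInvariant) : ωl.IsTranslationInvariant := by
  intro v
  refine InfVolFermionState.ext fun Λ => LinearMap.ext fun A => ?_
  rw [shift_expect]
  refine tendsto_nhds_unique (hlim (shiftSet v Λ) (fermionEmbed (PolySite.shiftEmb v Λ) A)) ?_
  have hrw : (fun j => (ω j).expect (shiftSet v Λ) (fermionEmbed (PolySite.shiftEmb v Λ) A)) =
      fun j => (ω j).expect Λ A := funext fun j => by
    rw [← shift_expect, hTI j v]
  rw [hrw]
  exact hlim Λ A

/-- **Evenness passes to weak-⋆ limits.** [cite: ArakiMoriya2003, §4.1 Def. 4.5] -/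
theorem isEven_of_tendsto_expect
    (hlim : ∀ (Λ : Finset (Site d)) (A : FermionOp Λ),
      Tendsto (fun j => (ω j).expect Λ A) atTop (𝓝 (ωl.expect Λ A)))
    (hE : ∀ j, (ω j).IsEven) : ωl.IsEven := by
  intro Λ A
  refine tendsto_nhds_unique (hlim Λ (parityAut A)) ?_
  have hrw : (fun j => (ω j).expect Λ (parityAut A)) = fun j => (ω j).expect Λ A :=
    funext fun j => hE j Λ A
  rw [hrw]
  exact hlim Λ A

/-- **The mean energy is weak-⋆ continuous** (it is the real part of the expectation of ONE local
observable `E_Ψ`). [cite: BratteliKishimotoRobinson1978, §3 (mean energy functional)] -/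
theorem tendsto_meanEnergy_of_tendsto_expect
    (hlim : ∀ (Λ : Finset (Site d)) (A : FermionOp Λ),
      Tendsto (fun j => (ω j).expect Λ A) atTop (𝓝 (ωl.expect Λ A)))
    (Ψ : FermionInteraction d) (R : ℝ) :
    Tendsto (fun j => (ω j).meanEnergy Ψ R) atTop (𝓝 (ωl.meanEnergy Ψ R)) :=
  (Complex.continuous_re.tendsto _).comp (hlim _ (Ψ.meanEnergyObs R))

/-- **Weak-⋆ limits of mean-energy minimisers are minimisers** (fixed interaction): the limit is
translation invariant and its mean energy is the limit `e₀(Ψ)` of the mean energies.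
[cite: BratteliKishimotoRobinson1978, Thm. 2 (condition 2)] -/
theorem isMeanEnergyMinimiser_of_tendsto_expect
    (hlim : ∀ (Λ : Finset (Site d)) (A : FermionOp Λ),
      Tendsto (fun j => (ω j).expect Λ A) atTop (𝓝 (ωl.expect Λ A)))
    {Ψ : FermionInteraction d} {R : ℝ} (hmin : ∀ j, (ω j).IsMeanEnergyMinimiser Ψ R) :
    ωl.IsMeanEnergyMinimiser Ψ R := by
  refine isMeanEnergyMinimiser_iff.2
    ⟨isTranslationInvariant_of_tendsto_expect hlim fun j => (hmin j).1, ?_⟩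
  exact le_of_tendsto' (tendsto_meanEnergy_of_tendsto_expect hlim Ψ R) fun j => (hmin j).meanEnergy_eq.le

open scoped Matrix.Norms.L2Operator in
/-- **Continuity of `e₀` along a pencil, sequential form**: if `s_j → sl` then
`e₀(Ψ₀ + s_jΨ₁) → e₀(Ψ₀ + slΨ₁)` (`e₀` is `‖E_{Ψ₁}‖`-Lipschitz along the pencil).
[cite: Israel1979, Thm. I.3.4] -/
theorem _root_.Literature.MathematicalPhysics.QuantumLattice.FermionInteraction.tendsto_tiGroundEnergyDensity_pencil
    (Ψ₀ Ψ₁ : FermionInteraction d) (R : ℝ) {s : ℕ → ℝ} {sl : ℝ} (hs : Tendsto s atTop (𝓝 sl)) :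
    Tendsto (fun j => (FermionInteraction.pencil Ψ₀ Ψ₁ (s j)).tiGroundEnergyDensity R) atTop
      (𝓝 ((FermionInteraction.pencil Ψ₀ Ψ₁ sl).tiGroundEnergyDensity R)) := by
  have hbound : ∀ j, |(FermionInteraction.pencil Ψ₀ Ψ₁ (s j)).tiGroundEnergyDensity R -
      (FermionInteraction.pencil Ψ₀ Ψ₁ sl).tiGroundEnergyDensity R| ≤ ‖Ψ₁.meanEnergyObs R‖ * |s j - sl| :=
    fun j => FermionInteraction.abs_tiGroundEnergyDensity_pencil_sub_le Ψ₀ Ψ₁ R (s j) sl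
  have h0 : Tendsto (fun j => ‖Ψ₁.meanEnergyObs R‖ * |s j - sl|) atTop (𝓝 0) := by
    have h1 : Tendsto (fun j => |s j - sl|) atTop (𝓝 0) := by
      simpa using (tendsto_sub_nhds_zero_iff.2 hs).abs
    simpa using h1.const_mul ‖Ψ₁.meanEnergyObs R‖
  have h2 : Tendsto (fun j => (FermionInteraction.pencil Ψ₀ Ψ₁ (s j)).tiGroundEnergyDensity R -
      (FermionInteraction.pencil Ψ₀ Ψ₁ sl).tiGroundEnergyDensity R) atTop (𝓝 0) :=
    squeeze_zero_norm (fun j => (Real.norm_eq_abs _).le.trans (hbound j)) h0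
  exact tendsto_sub_nhds_zero_iff.1 h2

open scoped Matrix.Norms.L2Operator in
/-- **Weak-⋆ limits of minimisers ALONG A PENCIL are minimisers at the limit coupling**: if `ω_j`
minimises the mean energy of `Ψ₀ + s_j Ψ₁`, `s_j → sl`, and `ω_j → ωl` pointwise, then `ωl` minimises the
mean energy of `Ψ₀ + sl Ψ₁` — since `e_{sl}(ω_j) = e₀(s_j) + (sl − s_j) e_{Ψ₁}(ω_j) → e₀(sl)` (Lipschitz
continuity of `e₀`, a priori bound `|e_{Ψ₁}| ≤ ‖E_{Ψ₁}‖`). Koma–Tasaki's `h → 0⁺` limit of sourced ground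
states is a source-free ground state. [cite: KomaTasaki1994, §1] -/
theorem isMeanEnergyMinimiser_pencil_of_tendsto_expect
    (hlim : ∀ (Λ : Finset (Site d)) (A : FermionOp Λ),
      Tendsto (fun j => (ω j).expect Λ A) atTop (𝓝 (ωl.expect Λ A)))
    {Ψ₀ Ψ₁ : FermionInteraction d} {R : ℝ} {s : ℕ → ℝ} {sl : ℝ} (hs : Tendsto s atTop (𝓝 sl))
    (hmin : ∀ j, (ω j).IsMeanEnergyMinimiser (FermionInteraction.pencil Ψ₀ Ψ₁ (s j)) R) :
    ωl.IsMeanEnergyMinimiser (FermionInteraction.pencil Ψ₀ Ψ₁ sl) R := by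
  refine isMeanEnergyMinimiser_iff.2
    ⟨isTranslationInvariant_of_tendsto_expect hlim fun j => (hmin j).1, ?_⟩
  have h1 := tendsto_meanEnergy_of_tendsto_expect hlim (FermionInteraction.pencil Ψ₀ Ψ₁ sl) R
  -- `e_{sl}(ω_j) = e₀(s_j) + (sl − s_j) e_{Ψ₁}(ω_j)`
  have h2 : ∀ j, (ω j).meanEnergy (FermionInteraction.pencil Ψ₀ Ψ₁ sl) R =
      (FermionInteraction.pencil Ψ₀ Ψ₁ (s j)).tiGroundEnergyDensity R +
        (sl - s j) * (ω j).meanEnergy Ψ₁ R := fun j => by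
    rw [(ω j).meanEnergy_pencil_eq_add_sub_mul Ψ₀ Ψ₁ (s j) sl R, (hmin j).meanEnergy_eq]
  have h3 := FermionInteraction.tendsto_tiGroundEnergyDensity_pencil Ψ₀ Ψ₁ R hs
  have h4 : Tendsto (fun j => (sl - s j) * (ω j).meanEnergy Ψ₁ R) atTop (𝓝 0) := by
    have hb : ∀ j, ‖(sl - s j) * (ω j).meanEnergy Ψ₁ R‖ ≤ |sl - s j| * ‖Ψ₁.meanEnergyObs R‖ := fun j => by
      rw [Real.norm_eq_abs, abs_mul]
      exact mul_le_mul_of_nonneg_left ((ω j).abs_meanEnergy_le_norm Ψ₁ R) (abs_nonneg _)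
    have h0 : Tendsto (fun j => |sl - s j| * ‖Ψ₁.meanEnergyObs R‖) atTop (𝓝 0) := by
      have h5 : Tendsto (fun j => |sl - s j|) atTop (𝓝 0) := by
        have h6 : Tendsto (fun j => sl - s j) atTop (𝓝 0) := by
          simpa using (tendsto_const_nhds (x := sl)).sub hs
        simpa using h6.abs
      simpa using h5.mul_const ‖Ψ₁.meanEnergyObs R‖
    exact squeeze_zero_norm hb h0
  have h6 : Tendsto (fun j => (ω j).meanEnergy (FermionInteraction.pencil Ψ₀ Ψ₁ sl) R) atTop
      (𝓝 ((FermionInteraction.pencil Ψ₀ Ψ₁ sl).tiGroundEnergyDensity R)) := by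
    have := h3.add h4
    rw [add_zero] at this
    exact this.congr fun j => (h2 j).symm
  exact (tendsto_nhds_unique h1 h6).le

end Closed

/-! ### Translation-invariant ground states exist -/

/-- **Existence of translation-invariant ground states (mean-energy minimisers).** For every interaction
`Ψ` of the lattice fermions on `ℤ^d` and every range parameter `R` there is a translation-invariant
infinite-volume state `ω` with `e_Ψ(ω) = e₀(Ψ) = inf {e_Ψ(ω') : ω' translation invariant}`: a minimising
sequence of translation-invariant states has a weak-⋆ convergent subsequence, whose limit is translation
invariant with the limit mean energy. (Bratteli–Kishimoto–Robinson 1978, Thm. 2: for quantum lattice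
systems these minimisers are exactly the translation-invariant ground states, a non-empty weak-⋆ closed
face.) [cite: BratteliKishimotoRobinson1978, Thm. 2] -/
theorem _root_.Literature.MathematicalPhysics.QuantumLattice.FermionInteraction.exists_isMeanEnergyMinimiser
    (Ψ : FermionInteraction d) (R : ℝ) :
    ∃ ω : InfVolFermionState d, ω.IsMeanEnergyMinimiser Ψ R := by
  -- a minimising sequence
  have hseq : ∀ n : ℕ, ∃ ω : InfVolFermionState d, ω.IsTranslationInvariant ∧
      ω.meanEnergy Ψ R < Ψ.tiGroundEnergyDensity R + 1 / ((n : ℝ) + 1) := fun n =>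
    Ψ.exists_meanEnergy_lt_of_tiGroundEnergyDensity_lt R (lt_add_of_pos_right _ (by positivity))
  choose ω hTI hlt using hseq
  obtain ⟨φ, hφ, ωl, hlim⟩ := exists_tendsto_expect_subseq ω
  refine ⟨ωl, isMeanEnergyMinimiser_iff.2
    ⟨isTranslationInvariant_of_tendsto_expect hlim fun j => hTI (φ j), ?_⟩⟩
  have hup : Tendsto (fun j => Ψ.tiGroundEnergyDensity R + 1 / (((φ j : ℕ) : ℝ) + 1)) atTop
      (𝓝 (Ψ.tiGroundEnergyDensity R)) := by
    have h0 : Tendsto (fun j => 1 / (((φ j : ℕ) : ℝ) + 1)) atTop (𝓝 0) :=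
      tendsto_one_div_add_atTop_nhds_zero_nat.comp hφ.tendsto_atTop
    simpa using (tendsto_const_nhds (x := Ψ.tiGroundEnergyDensity R)).add h0
  exact le_of_tendsto_of_tendsto' (tendsto_meanEnergy_of_tendsto_expect hlim Ψ R) hup
    fun j => (hlt (φ j)).le

/-- **Existence along a subsequence of ANY sequence of minimisers at varying couplings**: if `ω_j`
minimises the mean energy of `Ψ₀ + s_jΨ₁` and `s_j → sl`, some subsequence converges pointwise to a
minimiser at `sl` (compactness + `isMeanEnergyMinimiser_pencil_of_tendsto_expect`). [cite: KomaTasaki1994, §1] -/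
theorem exists_tendsto_expect_subseq_isMeanEnergyMinimiser_pencil
    {Ψ₀ Ψ₁ : FermionInteraction d} {R : ℝ} {s : ℕ → ℝ} {sl : ℝ} (hs : Tendsto s atTop (𝓝 sl))
    (ω : ℕ → InfVolFermionState d)
    (hmin : ∀ j, (ω j).IsMeanEnergyMinimiser (FermionInteraction.pencil Ψ₀ Ψ₁ (s j)) R) :
    ∃ φ : ℕ → ℕ, StrictMono φ ∧ ∃ ωl : InfVolFermionState d,
      (∀ (Λ : Finset (Site d)) (A : FermionOp Λ),
        Tendsto (fun j => (ω (φ j)).expect Λ A) atTop (𝓝 (ωl.expect Λ A))) ∧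
      ωl.IsMeanEnergyMinimiser (FermionInteraction.pencil Ψ₀ Ψ₁ sl) R := by
  obtain ⟨φ, hφ, ωl, hlim⟩ := exists_tendsto_expect_subseq ω
  exact ⟨φ, hφ, ωl, hlim, isMeanEnergyMinimiser_pencil_of_tendsto_expect hlim
    (hs.comp hφ.tendsto_atTop) fun j => hmin (φ j)⟩

end InfVolFermionState

end Literature.MathematicalPhysics.QuantumLattice

end
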